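import Summits.ABC.IUTFork.Joshi.GeometricCase1
import Summits.ABC.IUTFork.Joshi.GeometricCase2

/-!
# Joshi's geometric case — bridge §§12.3–12.8 (T-35, `GeometricCase1`) → §§12.9–12.18 (T-36, `GeometricCase2`):
# the interim carrier `GeoLocus.HeightDatum` discharged from `Geo.CoverSL2R` + `Geo.Level` (merge-debt of p430006) — no side taken

Record file of the abc-iut cell, branch E (rung LADDER-ABC:A2.E; seat abc-iut-E-t36, slot T-36; merge-debt reconciliation per
plan/E/ASSIGNMENTS.md §4 item 4). `Joshi/GeometricCase2.lean` (p430006) typed [J-III] (arXiv:2401.13508 v4) §§12.9–12.18 over an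
INTERIM signature `GeoLocus.HeightDatum Y` whose fields quote §§12.3–12.8; `Joshi/GeometricCase1.lean` (E-t35) has since typed
§§12.3–12.8 as `Geo.CoverSL2R Y` ((12.3.1), Def. 12.5.1: `proj`, `z`, `φ∞ = z²`, `ker proj = ⟨φ∞⟩`), `Geo.Level` (`ℓ ≥ 5` prime,
`ℓ* = (ℓ−1)/2`), `Geo.tauPt` / `Geo.CoverSL2R.ThetaGauLink` (Def. 12.8.3, reading F-b: «lying over» = `toH g̃_j = j²τ/2ℓ`). This
file BINDS the two BY NAME (nothing restated): `HeightDatum.ofCover D L h` is the §§12.9–12.18 signature of the cover `D`, the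
level `L` and a height `h : Y∞ → ℝ` (§12.13 — print defines `h` only by citation of [Zhang 2001], so it stays a parameter), with
`Provides g τ := ∀ j, toH (g̃_j) = j²τ/2ℓ` = the `over` clause of `ThetaGauLink`. DERIVED: `S̃L₂(ℚ)`, `S̃L₂(ℤ)`, `φ∞` agree
definitionally (`ofCover_ratl`, `ofCover_intl`, `ofCover_frob`); §12.11's `Θ_classical,τ` IS the set of T-35's Θgau-links over `τ`
(`mem_thetaClassicalTau_ofCover_iff`); the §12.9 fibre statement in T-35's log-link vocabulary (`exists_logLinkChain_ofCover`);
and OUR READING of Thm. 12.18.1 for every cover under (12.14.1) (`thm12181Reading_ofCover`). Remaining merge-debt: none on the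
group side; `GeoLocus.HeightDatum.schottkyParam` vs T-35's Schottky parameter of `E_{τ,j}` (file 2 of T-35, complex side) is
recorded for that file's bridge. Typed ≠ proved ≠ endorsed; [J-III] is an unrefereed preprint, disputed in print
(`Mochizuki2024JoshiReport`); nothing here bears on [IUTchIII] Cor. 3.12 or abc. [claim: Joshi2024ATS3, status: disputed]
-/

noncomputable section

open scoped MatrixGroups

namespace Summit.ABC.IUTFork.Joshi.ATS3.GeoLocus

open Summit.ABC.IUTFork.Joshi.ATS3.Geo

variable {Y : Type} [Group Y]

/-- `ℓ = 2ℓ* + 1` for T-35's `Level` (`ℓ ≥ 5` prime is odd). [folklore] -/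
theorem Level_two_mul_lstar_add_one (L : Level) : 2 * L.lstar + 1 = L.ell := by
  have h5 := L.five_le
  have hodd : Odd L.ell := L.prime.odd_of_ne_two (by omega)
  obtain ⟨k, hk⟩ := hodd
  rw [Level.lstar]
  omega

/-- **Merge-debt discharge (interim-carrier rule)**: the §§12.9–12.18 signature `HeightDatum` of p430006 built from T-35's
§§12.3–12.8 objects — the cover `D : CoverSL2R Y` ((12.3.1), Def. 12.5.1), the level `L` (§12.8: `ℓ`, `ℓ*`), and a height
`h : Y∞ → ℝ` (§12.13, p. 154 l. 1–10; a parameter: print defines it by citing [Zhang 2001]); `frob := φ∞ = z²`,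
`Provides g τ := ∀ j, toH (g̃_j) = j²τ/2ℓ` (Def. 12.8.3 as typed by T-35, flag F-b). [claim: Joshi2024ATS3, status: disputed] -/
def HeightDatum.ofCover (D : CoverSL2R Y) (L : Level) (h : Y → ℝ) : HeightDatum Y where
  lstar := L.lstar
  two_le_lstar := by
    have h5 := L.five_le
    rw [Level.lstar]
    omega
  ell_prime := by rw [Level_two_mul_lstar_add_one]; exact L.prime
  proj := D.proj
  proj_surjective := D.proj_surjective
  frob := D.phi
  frob_comm := fun g => Subgroup.mem_center_iff.1 D.phi_mem_center g
  ker_proj := D.ker_eq_zpowers_phi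
  h := h
  Provides := fun g τ => ∀ j, D.toH (g j) = tauPt L τ j

namespace HeightDatum

variable (D : CoverSL2R Y) (L : Level) (h : Y → ℝ)

/-- `ℓ` agrees. [folklore] -/
theorem ofCover_ell : (ofCover D L h).ell = L.ell := Level_two_mul_lstar_add_one L

/-- `ℓ*` agrees (definitionally). [folklore] -/
theorem ofCover_lstar : (ofCover D L h).lstar = L.lstar := rfl

/-- `ϕ∞` agrees (definitionally): `frob = CoverSL2R.phi = z²`. [folklore] -/
theorem ofCover_frob : (ofCover D L h).frob = D.phi := rfl

/-- `S̃L₂(ℚ)` agrees (definitionally): `ratl = CoverSL2R.coverSL2Q`. [folklore] -/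
theorem ofCover_ratl : (ofCover D L h).ratl = D.coverSL2Q := rfl

/-- `S̃L₂(ℤ)` agrees (definitionally): `intl = CoverSL2R.coverSL2Z`. [folklore] -/
theorem ofCover_intl : (ofCover D L h).intl = D.coverSL2Z := rfl

/-- The height is the supplied `h`. [folklore] -/
theorem ofCover_h : (ofCover D L h).h = h := rfl

/-- §12.11 ↔ Def. 12.8.3: a tuple lies in `Θ_classical,τ` (p. 153 l. 12–19, as typed in p430006) iff it is (the tuple of) one of
T-35's Θgau-links over `τ` (Def. 12.8.3 as typed in `GeometricCase1`). [folklore] -/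
theorem mem_thetaClassicalTau_ofCover_iff (τ : UpperHalfPlane) (g : Fin L.lstar → Y) :
    g ∈ (ofCover D L h).thetaClassicalTau τ ↔ ∃ Λ : D.ThetaGauLink L, Λ.τ = τ ∧ Λ.g = g := by
  constructor
  · rintro ⟨hmem, hover⟩
    exact ⟨⟨τ, g, hmem, hover⟩, rfl, rfl⟩
  · rintro ⟨Λ, rfl, rfl⟩
    exact ⟨Λ.mem, Λ.over⟩

/-- (12.12.1) ↔ Def. 12.8.3: an `S`-family lies in `Θ_classical` iff each row is a Θgau-link over `τ_s`. [folklore] -/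
theorem mem_thetaClassical_ofCover_iff {n : ℕ} (τs : Fin n → UpperHalfPlane) (g : Fin n → Fin L.lstar → Y) :
    g ∈ (ofCover D L h).thetaClassical τs ↔ ∀ s, ∃ Λ : D.ThetaGauLink L, Λ.τ = τs s ∧ Λ.g = g s :=
  forall_congr' fun s => mem_thetaClassicalTau_ofCover_iff D L h (τs s) (g s)

/-- §12.9 in T-35's log-link vocabulary: two members of one fibre of the log-Θ-lattice are, coordinatewise, on one CHAIN OF
LOG-LINKS (Def. 12.6.1, `CoverSL2R.logLinkChain`). [folklore] -/
theorem exists_logLinkChain_ofCover (Λ : (ofCover D L h).LogThetaLattice) (n m m' : ℤ) (j : Fin L.lstar) :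
    ∃ k : ℤ, Λ.theta (n, m') j = D.logLinkChain (Λ.theta (n, m) j) k :=
  LogThetaLattice.exists_zpow_frob (ofCover D L h) Λ n m m' j

/-- OUR READING of Thm. 12.18.1 holds for EVERY cover `S̃L₂(ℝ) → SL₂(ℝ)` as typed by T-35, every level, every height satisfying
(12.14.1), every domain locus and every monodromy datum (`S ≠ ∅`): the geometric «Cor. 3.12» is carried by subadditivity +
membership. [folklore] -/
theorem thm12181Reading_ofCover (hsub : (ofCover D L h).HeightSubadditive) {Pi : Type} [Group Pi] {genus n : ℕ}
    (hn : 0 < n) (Lc : (ofCover D L h).DomainLocus n) (M : MonodromyDatum Pi genus n) :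
    (ofCover D L h).Thm12181Reading Lc M :=
  (ofCover D L h).thm12181Reading_of_subadditive hsub hn Lc M

/-- (12.14.1) for the cover is literally subadditivity of the supplied `h`. [folklore] -/
theorem heightSubadditive_ofCover_iff : (ofCover D L h).HeightSubadditive ↔ ∀ g₁ g₂ : Y, h (g₁ * g₂) ≤ h g₁ + h g₂ := Iff.rfl

/-- (12.15.1) for the cover reads through T-35's `φ∞`: `h(g̃·φ∞^m) ≤ h(g̃) + π·m`. [folklore] -/
theorem heightLogLinkBound_ofCover_iff :
    (ofCover D L h).HeightLogLinkBound ↔ ∀ (g : Y) (m : ℤ), h (D.logLinkChain g m) ≤ h g + Real.pi * m := Iff.rfl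

end HeightDatum

end Summit.ABC.IUTFork.Joshi.ATS3.GeoLocus
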